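import Summits.AtomisticToContinuum.Crystallization.Theorems.ChessboardParticlePlanesLjLaminarWindowsVirial
import Summits.AtomisticToContinuum.Crystallization.Theorems.PRVarianceCertificateCoerciveToDefectVanish
import Summits.AtomisticToContinuum.Crystallization.Theorems.ChargedEnergyGap.Negative.Tolerance
import Literature.MathematicalPhysics.StatisticalMechanics.LennardJonesThermodynamicLimitProofs
import Literature.MathematicalPhysics.StatisticalMechanics.BarlowStacking

/-!
# `CoerciveVarianceCertificate` (stmt-AtomisticToContinuum-11860), line `birth`: stub `stub_pricingSmall`

Small Lennard-Jones clusters are priced by participation.  For a configuration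
`x : Fin N → ℝ³` write `sᵢ = ∑_{k ≠ i} r_{ik}⁻⁶` (`siteEnergy (fun r => (r⁻¹) ^ 6) x i`) and
`tᵢ = ∑_{k ≠ i} r_{ik}⁻¹²` (`siteEnergy (fun r => (r⁻¹) ^ 12) x i`).  If the hcp energy per
particle satisfies `e := e_LJ(hcp_{a,h}) ≤ -0.7175`, so that the pinned certificate constant
`C := -24 e` is `≥ 17.22`, then every Lennard-Jones ground state `x` of `2 ≤ N ≤ 18` particles has
`N / 50 ≤ C ∑ᵢ tᵢ - ∑ᵢ sᵢ²` (`stub_pricingSmall`, the registered sub-goal of the skeleton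
`Cruxes/CoerciveVarianceCertificate/Lines/birth.lean`).

Mechanism (the variance certificate at its crudest):
* Cauchy–Schwarz per site, `sᵢ² ≤ (N - 1) tᵢ` (`sq_siteEnergy_six_le`), so `∑ sᵢ² ≤ 17 ∑ tᵢ`;
* the virial identity of a ground state (`LjLaminarWindowsSketch.virial_sum_inv_pow_eq`,
  `∑_{i<j} r⁻¹² = ∑_{i<j} r⁻⁶`) and double counting give `∑ tᵢ = ∑ sᵢ = -24 E(N)`
  (`sum_siteEnergy_twelve_eq_six`, `sum_siteEnergy_twelve_eq`);
* `E(N) ≤ E(2) + E(N - 2) ≤ -1/12 + 0` (subadditivity, the unit dimer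
  `ChargedEnergyGapNegative.dimer`, `E(M) ≤ 0` = `ChargedEnergyGapNegative.groundStateEnergy_nonpos`;
  `groundStateEnergy_lennardJones_le_of_two_le`), so `∑ tᵢ ≥ 2` and the deficit is
  `≥ (17.22 - 17) · 2 = 0.44 ≥ 18/50 ≥ N/50`.

All statements are `[folklore]` (Blanc–Lewin 2015, §1.2 for the energetics).  Not here: the
`N ≥ 19` kernel (`stub_pricingLarge`) and the hcp energy bound itself (`stub_hcpEnergyBound`),
which enters only as a hypothesis.
-/

noncomputable section

namespace Summit.AtomisticToContinuum.Crystallization.Theorems.PRVarianceCertificate.CoerciveVarianceCertificate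

open scoped BigOperators
open Literature.MathematicalPhysics.StatisticalMechanics
open Summit.AtomisticToContinuum.Crystallization.Theorems.LjLaminarWindowsSketch (virial_sum_inv_pow_eq)
open Summit.AtomisticToContinuum.Crystallization.Theorems.ChargedEnergyGapNegative (dimer dimer_injective
  interactionEnergy_dimer groundStateEnergy_nonpos)

/-! ## Participation: Cauchy–Schwarz per site -/

/-- **Participation bound.** `sᵢ² ≤ (N - 1) tᵢ`: Cauchy–Schwarz for the `N - 1` numbers
`r_{ik}⁻⁶`, `k ≠ i`, whose squares are the `r_{ik}⁻¹²`. [folklore] -/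
theorem sq_siteEnergy_six_le {N : ℕ} (x : Fin N → EuclideanSpace ℝ (Fin 3)) (i : Fin N) :
    (siteEnergy (fun r => (r⁻¹) ^ 6) x i) ^ 2 ≤
      ((N : ℝ) - 1) * siteEnergy (fun r => (r⁻¹) ^ 12) x i := by
  have h := sq_sum_le_card_mul_sum_sq (s := Finset.univ.erase i)
    (f := fun k => (dist (x i) (x k))⁻¹ ^ 6)
  have hN : 1 ≤ N := Fin.pos i
  have hcard : (((Finset.univ : Finset (Fin N)).erase i).card : ℝ) = (N : ℝ) - 1 := by
    rw [Finset.card_erase_of_mem (Finset.mem_univ i), Finset.card_univ, Fintype.card_fin,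
      Nat.cast_sub hN, Nat.cast_one]
  have hsq : ∀ k ∈ Finset.univ.erase i,
      ((dist (x i) (x k))⁻¹ ^ 6) ^ 2 = (dist (x i) (x k))⁻¹ ^ 12 := fun k _ => by
    rw [← pow_mul]
  rw [hcard, Finset.sum_congr rfl hsq] at h
  simpa only [siteEnergy] using h

/-- Summing the participation bound: `∑ᵢ sᵢ² ≤ (N - 1) ∑ᵢ tᵢ`. [folklore] -/
theorem sum_sq_siteEnergy_six_le {N : ℕ} (x : Fin N → EuclideanSpace ℝ (Fin 3)) :
    ∑ i, (siteEnergy (fun r => (r⁻¹) ^ 6) x i) ^ 2 ≤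
      ((N : ℝ) - 1) * ∑ i, siteEnergy (fun r => (r⁻¹) ^ 12) x i := by
  rw [Finset.mul_sum]
  exact Finset.sum_le_sum fun i _ => sq_siteEnergy_six_le x i

/-! ## The virial identity in site form -/

/-- **Virial identity, site form.** In a Lennard-Jones ground state `∑ᵢ tᵢ = ∑ᵢ sᵢ`: double
counting `∑ᵢ 𝓔ⁱ = 2 ∑_{i<j}` (`two_mul_interactionEnergy`) and the pair form
`∑_{i<j} r⁻¹² = ∑_{i<j} r⁻⁶` (`virial_sum_inv_pow_eq`). [folklore] -/
theorem sum_siteEnergy_twelve_eq_six {N : ℕ} {x : Fin N → EuclideanSpace ℝ (Fin 3)}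
    (hx : IsGroundState lennardJones x) :
    ∑ i, siteEnergy (fun r => (r⁻¹) ^ 12) x i = ∑ i, siteEnergy (fun r => (r⁻¹) ^ 6) x i := by
  rw [← two_mul_interactionEnergy, ← two_mul_interactionEnergy]
  congr 1
  unfold interactionEnergy
  exact virial_sum_inv_pow_eq hx

/-- Hence `∑ᵢ tᵢ = -24 E(N)` in a Lennard-Jones ground state of `N` particles in `ℝ³`
(`2 E = T/12 - S/6` with `S = T`). [folklore] -/
theorem sum_siteEnergy_twelve_eq {N : ℕ} {x : Fin N → EuclideanSpace ℝ (Fin 3)}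
    (hx : IsGroundState lennardJones x) :
    ∑ i, siteEnergy (fun r => (r⁻¹) ^ 12) x i = -24 * groundStateEnergy lennardJones 3 N := by
  have h := two_mul_interactionEnergy_lennardJones_eq_inv_pow x
  rw [hx.2, ← sum_siteEnergy_twelve_eq_six hx] at h
  linarith

/-! ## `E(N) ≤ -1/12` for `N ≥ 2` -/

/-- **The unit dimer.** `E(2) ≤ V_LJ(1) = -1/12` in `ℝ³`: test the infimum `E(2)` on the
injective configuration `{0, e₀}` at distance `1` (the tree's `ChargedEnergyGapNegative.dimer`,
`interactionEnergy_dimer`). [folklore] -/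
theorem groundStateEnergy_lennardJones_two_le :
    groundStateEnergy lennardJones 3 2 ≤ -1 / 12 :=
  (groundStateEnergy_lennardJones_le (d := 3) dimer_injective).trans_eq interactionEnergy_dimer

/-- **`E(N) ≤ -1/12` for `N ≥ 2`** (Lennard-Jones, `ℝ³`): `E(N) ≤ E(2) + E(N - 2)`
(subadditivity, Blanc–Lewin 2015 (4)) with `E(2) ≤ -1/12` and `E(N - 2) ≤ 0`
(`ChargedEnergyGapNegative.groundStateEnergy_nonpos`). [folklore] -/
theorem groundStateEnergy_lennardJones_le_of_two_le {N : ℕ} (hN : 2 ≤ N) :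
    groundStateEnergy lennardJones 3 N ≤ -1 / 12 := by
  have hsub := subadditive_groundStateEnergy_lennardJones (by norm_num : 0 < 3)
  have h : groundStateEnergy lennardJones 3 (2 + (N - 2)) ≤
      groundStateEnergy lennardJones 3 2 + groundStateEnergy lennardJones 3 (N - 2) := hsub 2 (N - 2)
  rw [show 2 + (N - 2) = N from by omega] at h
  linarith [groundStateEnergy_lennardJones_two_le, groundStateEnergy_nonpos (N - 2)]

/-- Consequently `∑ᵢ tᵢ ≥ 2` in every Lennard-Jones ground state of `N ≥ 2` particles in `ℝ³`
(`∑ tᵢ = -24 E(N) ≥ -24 · (-1/12)`). [folklore] -/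
theorem two_le_sum_siteEnergy_twelve {N : ℕ} {x : Fin N → EuclideanSpace ℝ (Fin 3)}
    (hx : IsGroundState lennardJones x) (hN : 2 ≤ N) :
    2 ≤ ∑ i, siteEnergy (fun r => (r⁻¹) ^ 12) x i := by
  rw [sum_siteEnergy_twelve_eq hx]
  linarith [groundStateEnergy_lennardJones_le_of_two_le hN]

/-! ## The registered stub -/

/-- **Registered sub-goal `stub_pricingSmall` of line `birth` (crux `CoerciveVarianceCertificate`):
small clusters are priced by participation.**  If `e_LJ(hcp_{a,h}) ≤ -0.7175` (so
`C := -24 e ≥ 17.22`) then every Lennard-Jones ground state `x` of `2 ≤ N ≤ 18` particles has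
`N / 50 ≤ C ∑ᵢ tᵢ - ∑ᵢ sᵢ²`: by `∑ sᵢ² ≤ (N - 1) ∑ tᵢ ≤ 17 ∑ tᵢ` and `∑ tᵢ ≥ 2` the deficit is
`≥ 0.22 · 2 = 0.44 ≥ 18/50 ≥ N/50`. [folklore] -/
theorem stub_pricingSmall : ∀ (a h : ℝ) (ha : 0 < a) (hh : 0 < h), (Literature.MathematicalPhysics.StatisticalMechanics.hcpPeriodicConfiguration ha.ne' hh.ne').energyPerParticle Literature.MathematicalPhysics.StatisticalMechanics.lennardJones ≤ -(7175 / 10000) → ∀ (N : ℕ) (x : Fin N → EuclideanSpace ℝ (Fin 3)), Literature.MathematicalPhysics.StatisticalMechanics.IsGroundState Literature.MathematicalPhysics.StatisticalMechanics.lennardJones x → 2 ≤ N → N ≤ 18 → (1 / 50 : ℝ) * N ≤ (-(24 : ℝ) * (Literature.MathematicalPhysics.StatisticalMechanics.hcpPeriodicConfiguration ha.ne' hh.ne').energyPerParticle Literature.MathematicalPhysics.StatisticalMechanics.lennardJones) * ∑ i, Literature.MathematicalPhysics.StatisticalMechanics.siteEnergy (fun r => (r⁻¹) ^ 12) x i -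 ∑ i, (Literature.MathematicalPhysics.StatisticalMechanics.siteEnergy (fun r => (r⁻¹) ^ 6) x i) ^ 2 := by
  intro a h ha hh he N x hx hN2 hN18
  have hS2 := sum_sq_siteEnergy_six_le x
  have hT2 := two_le_sum_siteEnergy_twelve hx hN2
  have hN18' : (N : ℝ) ≤ 18 := by exact_mod_cast hN18
  set e := (hcpPeriodicConfiguration ha.ne' hh.ne').energyPerParticle lennardJones with he_def
  set T := ∑ i, siteEnergy (fun r => (r⁻¹) ^ 12) x i with hT_def
  have hT0 : 0 ≤ T := by linarith
  -- participation: `∑ s² ≤ (N - 1) T ≤ 17 T`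
  have h1 : ((N : ℝ) - 1) * T ≤ 17 * T :=
    mul_le_mul_of_nonneg_right (by linarith) hT0
  -- the certificate constant: `C T ≥ 17.22 T`
  have h2 : (1722 / 100 : ℝ) * T ≤ (-(24 : ℝ) * e) * T :=
    mul_le_mul_of_nonneg_right (by linarith) hT0
  linarith
  
end Summit.AtomisticToContinuum.Crystallization.Theorems.PRVarianceCertificate.CoerciveVarianceCertificate

end
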